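import Literature.AlgebraicGeometry.Motives.DiagonalHypersurfaceFrobeniusEigenvalues
import Literature.AlgebraicGeometry.Motives.DiagonalHypersurfaceFunctionalEquationSign
import HarnessLib

/-!
# `det(F | Hⁿ(X)) = ε · q^{n·bₙ/2}` for the diagonal hypersurface `X = V₊(Σ βᵢ xᵢ^d) ⊂ ℙⁿ⁺¹_{𝔽_q}` (`d ∣ q − 1`),
# with the sign EXPLICIT: `ε = +1` unless `n` and `d` are both even, and then `ε = ((−1)^{n/2+1} β₀⋯β_{n+1} / 𝔽_q)`

Topic `Literature/AlgebraicGeometry/Motives`; THEOREMS ONLY (no definition, no instance, no named fact; D-0026).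
Kahn's Prop. 6.46 (3) ∕ Exercise 6.56 («`det(π_M) = ± q^{iχ(M)/2}` … `det(π_M) > 0` … sign `+1`») and the hypothesis
`hε : det(F | Hᵈ(X)) = ε · q^{d b_d/2}` of the tree's `ZetaFunctionalEquationSignEvenDimension` (g40), DISCHARGED for a
concrete family: in any Galois Weil cohomology `E` over `𝔽_q` with the Lefschetz trace formula, `χ(φ) = q`, granted RH
for `X` in `E` (`n ≥ 1`).  The computation: `det F = (−1)^{bₙ} lc(Pₙ)` (tree, `det_frobAction_eq_intCast_of_isIntegralModel`),
`Pₙ = (1 − q^{n/2}T)^{[n even]} · P₁` with `P₁ ↦ Π_{a∈𝓐}(1 − α_aT)` (g49-#9), `lc(P₁) = Π_{a∈𝓐}(−α_a)` computed in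
g49-#8: the free orbits `{a ≠ a'}` of the involution `a ↦ (d − aᵢ)ᵢ` contribute `qⁿ` each (there is an even number of
free indices — §1), and the fixed point `a₀ = (d/2,…,d/2)` (present iff `d`, `n` even) contributes
`−α_{a₀} = −η((−1)^{n/2+1}Πβᵢ)·q^{n/2}`, `η` the Legendre symbol.

* §1 `even_card_filter_weilIndex_compl_ne` (the free part of Weil's index set has even cardinality — a fixed-point-free
  involution, counted in `ZMod 2`), `card_weilIndexSet_eq_card_filter_add`, `even_card_weilIndexSet_of_not`,
  `even_mul_card_weilIndexSet_of_not` (`2 ∣ n·M` when `n` or `d` is odd).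
* §2 the integer `lc(P₁)`: `natDegree_eq_card_weilIndexSet_of_map_eq_prod`, **`leadingCoeff_eq_pow_of_map_eq_prod`**
  (`lc(P₁) = q^{nM/2}`, `n` or `d` odd), **`leadingCoeff_eq_neg_quadraticChar_mul_pow_of_map_eq_prod`**
  (`lc(P₁) = −(Δ/𝔽_q)·q^{nM/2}`, `n`, `d` even, `Δ = (−1)^{n/2+1}Πβᵢ`).
* §3 **`det_frobAction_diagonalHypersurface_middle`** (`n` or `d` odd: `det(F | Hⁿ(X)) = q^{n·bₙ/2}`; for `n` odd this is
  unconditional in `d` — no hard Lefschetz needed, cf. the tree's `FrobeniusDeterminantOddMiddleDegree`),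
  **`det_frobAction_diagonalHypersurface_middle_of_even`** (`n`, `d` even: `det(F | Hⁿ(X)) = (Δ/𝔽_q)·q^{n·bₙ/2}` — for
  the quadric surface the Legendre symbol of the discriminant: Kahn's Remark 3.66 ∕ the tree's `N₋ = 1` example).

## References

* [Kahn2020] B. Kahn, Zeta and L-Functions of Varieties and Motives, LMS LNS 462 (2020), §3.6 (3.6.4)–(3.6.6), Remark
  3.66; §6.13 Prop. 6.46 (3), Exercise 6.56.
* [Deligne1974] P. Deligne, La conjecture de Weil. I, Publ. Math. IHÉS 43 (1974), (1.5.4), Th. (1.6), (2.6).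
* [Weil1949] A. Weil, Bull. AMS 55 (1949) 497–508, p. 507.
* [IrelandRosen1990] K. Ireland, M. Rosen, GTM 84 (1990), Ch. 11 §3 (b)–(c) p. 167; Ch. 8 §6.
* Tree: `Motives/FrobeniusTracesIndependentOfTheory` (`det_frobAction_eq_intCast_of_isIntegralModel`,
  `finrank_eq_natDegree_of_isIntegralModel`), `Motives/DiagonalHypersurfaceFrobeniusEigenvalues` (g49-#9
  `weil1949Numerator_map_eq`), `Motives/DiagonalHypersurfaceFunctionalEquationSign` (g49-#8 `prod_neg_recipRoot_of_not_even`,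
  `prod_neg_recipRoot_of_even`, `centralRecipRoot_eq`, `isQuadratic_apply_eq_quadraticChar`,
  `filter_weilIndex_compl_eq_self_of_not/_of_even`), `Motives/DiagonalHypersurfaceFunctionalEquation` (g49-#7
  `natDegree_prod_one_sub_C_mul_X`, `recipRootIndex_compl_compl`), GaussSums `compl_mem_indexSet`, `recipRoot_ne_zero`.

## Provenance

Lane `lit-hodgefound` (summit `HodgeConjecture`, Track 2 foundations library, Layer B: motives / Weil cohomology over
finite fields), seat `lit-hodgefound-p29` (literature-prover, generation 49, row g49-#12).
-/

universe u v

open Polynomial Finset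
open scoped LinearAlgebra.Projectivization
open Literature.NumberTheory.GaussSums

noncomputable section

namespace Literature.AlgebraicGeometry.Motives

open SmoothHypersurface

/-! ### §1 Parity of Weil's index set -/

section Parity

variable {n d : ℕ}

/-- **The free part `{a ∈ 𝓐 : a' ≠ a}` of Weil's index set has even cardinality** — `a ↦ a' = (d − aᵢ)ᵢ` is a
fixed-point-free involution of it (counted in `ZMod 2`). [cite: IrelandRosen1990, Ch. 11 §3, statement (b) p. 167] -/
theorem even_card_filter_weilIndex_compl_ne :
    Even #(((Fintype.piFinset fun _ : Fin (n + 2) ↦ range d).filter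
      fun a => (∀ i, a i ≠ 0) ∧ d ∣ ∑ i, a i).filter (fun a => ¬(fun i => d - a i) = a)) := by
  rw [← ZMod.natCast_eq_zero_iff_even, Finset.card_eq_sum_ones, Nat.cast_sum]
  simp only [Nat.cast_one]
  refine Finset.sum_involution (fun a _ => fun i => d - a i) ?_ ?_ ?_ ?_
  · intro a ha
    decide
  · intro a ha _
    exact (Finset.mem_filter.mp ha).2
  · intro a ha
    obtain ⟨haA, hne⟩ := Finset.mem_filter.mp ha
    refine Finset.mem_filter.mpr ⟨compl_mem_indexSet haA, ?_⟩
    rw [recipRootIndex_compl_compl haA]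
    exact fun h => hne h.symm
  · intro a ha
    exact recipRootIndex_compl_compl (Finset.mem_filter.mp ha).1

/-- `#𝓐 = #{a ≠ a'} + [d, n even]` (`d ≠ 0`): the fixed points are `{(d/2,…,d/2)}` or none (g49-#8).
[cite: IrelandRosen1990, Ch. 11 §3, statement (b) p. 167] -/
theorem card_weilIndexSet_eq_card_filter_add (hd0 : d ≠ 0) :
    #((Fintype.piFinset fun _ : Fin (n + 2) => range d).filter fun a => (∀ i, a i ≠ 0) ∧ d ∣ ∑ i, a i) =
      #(((Fintype.piFinset fun _ : Fin (n + 2) ↦ range d).filter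
          fun a => (∀ i, a i ≠ 0) ∧ d ∣ ∑ i, a i).filter (fun a => ¬(fun i => d - a i) = a)) +
        if Even d ∧ Even n then 1 else 0 := by
  rw [← Finset.card_filter_add_card_filter_not (fun a : Fin (n + 2) → ℕ => (fun i => d - a i) = a),
    add_comm]
  congr 1
  split_ifs with h
  · rw [filter_weilIndex_compl_eq_self_of_even h.1 h.2 hd0, Finset.card_singleton]
  · rw [filter_weilIndex_compl_eq_self_of_not h, Finset.card_empty]

/-- `n` or `d` odd (`d ≠ 0`): `#𝓐` is even. [cite: IrelandRosen1990, Ch. 11 §3, statement (b) p. 167] -/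
theorem even_card_weilIndexSet_of_not (hd0 : d ≠ 0) (h : ¬(Even d ∧ Even n)) :
    Even #((Fintype.piFinset fun _ : Fin (n + 2) => range d).filter fun a => (∀ i, a i ≠ 0) ∧ d ∣ ∑ i, a i) := by
  rw [card_weilIndexSet_eq_card_filter_add hd0, if_neg h, add_zero]
  exact even_card_filter_weilIndex_compl_ne

/-- `n` or `d` odd (`d ≠ 0`): `n · #𝓐` is even (`n·bₙ` even off the fixed point; Kahn's Exercise 3.67 «the integer `nχ`
… is always even» for this family). [cite: Kahn2020, §3.6 Exercise 3.67] -/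
theorem even_mul_card_weilIndexSet_of_not (hd0 : d ≠ 0) (h : Odd n ∨ Odd d) :
    Even (n * #((Fintype.piFinset fun _ : Fin (n + 2) => range d).filter fun a => (∀ i, a i ≠ 0) ∧ d ∣ ∑ i, a i)) := by
  rcases Nat.even_or_odd n with hn | hn
  · exact hn.mul_right _
  · refine Even.mul_left (even_card_weilIndexSet_of_not hd0 fun ⟨hd2, hn2⟩ => ?_) _
    rcases h with h | h
    · exact (Nat.not_even_iff_odd.mpr h) hn2
    · exact (Nat.not_even_iff_odd.mpr h) hd2

end Parity

/-! ### §2 The integer leading coefficient of Weil's numerator -/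

section LeadingCoeff

variable {k : Type u} [Field k] [Fintype k] [DecidableEq k] {n : ℕ} [Fintype (ℙ k (Fin (n + 2) → k))]

/-- `deg P₁ = #𝓐` for an integer polynomial `P₁ ↦ Π_{a∈𝓐}(1 − α_aT)`. [cite: Weil1949, p. 507] -/
theorem natDegree_eq_card_weilIndexSet_of_map_eq_prod {d : ℕ} {χ : MulChar k ℂ} (hχ : orderOf χ = d) (β : Fin (n + 2) → kˣ)
    {ψ : AddChar k ℂ} (hψ : ψ ≠ 1) {P₁ : ℤ[X]}
    (hP₁ : P₁.map (Int.castRingHom ℂ) =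
      ∏ a ∈ (Fintype.piFinset fun _ : Fin (n + 2) ↦ range d) with (∀ i, a i ≠ 0) ∧ d ∣ ∑ i, a i,
        (1 - C ((-1 : ℂ) ^ n * ((∏ i, (χ ^ a i) ((β i)⁻¹ : kˣ)) * jacobiSumProj (fun i ↦ χ ^ a i))) * X :
          ℂ[X])) :
    P₁.natDegree = #((Fintype.piFinset fun _ : Fin (n + 2) => range d).filter
      fun a => (∀ i, a i ≠ 0) ∧ d ∣ ∑ i, a i) := by
  rw [← natDegree_map_eq_of_injective (Int.castRingHom ℂ).injective_int P₁, hP₁,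
    natDegree_prod_one_sub_C_mul_X _ (fun a ha => recipRoot_ne_zero hχ β hψ ha)]

/-- The leading coefficient over `ℂ`: `lc(P₁) = Π_{a∈𝓐}(−α_a)`. [cite: Weil1949, p. 507] -/
theorem intCast_leadingCoeff_of_map_eq_prod {d : ℕ} {χ : MulChar k ℂ} (hχ : orderOf χ = d) (β : Fin (n + 2) → kˣ)
    {ψ : AddChar k ℂ} (hψ : ψ ≠ 1) {P₁ : ℤ[X]}
    (hP₁ : P₁.map (Int.castRingHom ℂ) =
      ∏ a ∈ (Fintype.piFinset fun _ : Fin (n + 2) ↦ range d) with (∀ i, a i ≠ 0) ∧ d ∣ ∑ i, a i,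
        (1 - C ((-1 : ℂ) ^ n * ((∏ i, (χ ^ a i) ((β i)⁻¹ : kˣ)) * jacobiSumProj (fun i ↦ χ ^ a i))) * X :
          ℂ[X])) :
    ((P₁.leadingCoeff : ℤ) : ℂ) =
      ∏ a ∈ (Fintype.piFinset fun _ : Fin (n + 2) ↦ range d) with (∀ i, a i ≠ 0) ∧ d ∣ ∑ i, a i,
        (-((-1 : ℂ) ^ n * ((∏ i, (χ ^ a i) ((β i)⁻¹ : kˣ)) * jacobiSumProj (fun i ↦ χ ^ a i)))) := by
  rw [← eq_intCast (Int.castRingHom ℂ), ← leadingCoeff_map_of_injective (Int.castRingHom ℂ).injective_int, hP₁,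
    leadingCoeff_prod_one_sub_C_mul_X _ (fun a ha => recipRoot_ne_zero hχ β hψ ha)]

/-- **`lc(P₁) = q^{n·M/2}` when `n` or `d` is odd** (`M = #𝓐`; `Π_𝓐(−α_a) = (√q)^{nM}` with `nM` even).
[cite: Weil1949, p. 507] [cite: Kahn2020, §6.13 Prop. 6.46 (3)] -/
theorem leadingCoeff_eq_pow_of_map_eq_prod {d : ℕ} (h : Odd n ∨ Odd d) (hd : d ∣ Fintype.card k - 1)
    {χ : MulChar k ℂ} (hχ : orderOf χ = d) (β : Fin (n + 2) → kˣ) {ψ : AddChar k ℂ} (hψ : ψ ≠ 1) {P₁ : ℤ[X]}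
    (hP₁ : P₁.map (Int.castRingHom ℂ) =
      ∏ a ∈ (Fintype.piFinset fun _ : Fin (n + 2) ↦ range d) with (∀ i, a i ≠ 0) ∧ d ∣ ∑ i, a i,
        (1 - C ((-1 : ℂ) ^ n * ((∏ i, (χ ^ a i) ((β i)⁻¹ : kˣ)) * jacobiSumProj (fun i ↦ χ ^ a i))) * X :
          ℂ[X])) :
    P₁.leadingCoeff = (Fintype.card k : ℤ) ^ (n * #((Fintype.piFinset fun _ : Fin (n + 2) => range d).filter
      fun a => (∀ i, a i ≠ 0) ∧ d ∣ ∑ i, a i) / 2) := by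
  have hd0 : d ≠ 0 := by
    rintro rfl
    rw [zero_dvd_iff] at hd
    have := Fintype.one_lt_card (α := k)
    omega
  have hne : ¬(Even d ∧ Even n) := by
    rintro ⟨hd2, hn2⟩
    rcases h with h | h
    · exact (Nat.not_even_iff_odd.mpr h) hn2
    · exact (Nat.not_even_iff_odd.mpr h) hd2
  obtain ⟨m, hm⟩ := even_mul_card_weilIndexSet_of_not (n := n) hd0 h
  apply Int.cast_injective (α := ℂ)
  rw [intCast_leadingCoeff_of_map_eq_prod hχ β hψ hP₁, prod_neg_recipRoot_of_not_even hne hχ β hψ, ← pow_mul, hm,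
    ← two_mul, Nat.mul_div_cancel_left _ two_pos, pow_mul, ← Complex.ofReal_pow, Real.sq_sqrt (Nat.cast_nonneg _)]
  push_cast
  rfl

/-- **`lc(P₁) = −(Δ/𝔽_q)·q^{n·M/2}` when `n` and `d` are even** (`Δ = (−1)^{n/2+1}Πβᵢ`, `M = #𝓐` odd): the fixed point
`a₀` contributes `−α_{a₀} = −(Δ/𝔽_q)q^{n/2}`, the free part `q^{n(M−1)/2}`. [cite: Weil1949, p. 507]
[cite: Kahn2020, §3.6 Remark 3.66; §6.13 Prop. 6.46 (3)] -/
theorem leadingCoeff_eq_neg_quadraticChar_mul_pow_of_map_eq_prod {d : ℕ} (hn : Even n) (hd2 : Even d)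
    (hd : d ∣ Fintype.card k - 1) {χ : MulChar k ℂ} (hχ : orderOf χ = d) (β : Fin (n + 2) → kˣ) {ψ : AddChar k ℂ}
    (hψ : ψ ≠ 1) {P₁ : ℤ[X]}
    (hP₁ : P₁.map (Int.castRingHom ℂ) =
      ∏ a ∈ (Fintype.piFinset fun _ : Fin (n + 2) ↦ range d) with (∀ i, a i ≠ 0) ∧ d ∣ ∑ i, a i,
        (1 - C ((-1 : ℂ) ^ n * ((∏ i, (χ ^ a i) ((β i)⁻¹ : kˣ)) * jacobiSumProj (fun i ↦ χ ^ a i))) * X :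
          ℂ[X])) :
    P₁.leadingCoeff = -(quadraticChar k ((-1) ^ (n / 2 + 1) * ∏ i, (β i : k)) : ℤ) *
      (Fintype.card k : ℤ) ^ (n * #((Fintype.piFinset fun _ : Fin (n + 2) => range d).filter
        fun a => (∀ i, a i ≠ 0) ∧ d ∣ ∑ i, a i) / 2) := by
  have hd0 : d ≠ 0 := by
    rintro rfl
    rw [zero_dvd_iff] at hd
    have := Fintype.one_lt_card (α := k)
    omega
  obtain ⟨m, hm⟩ := hn
  have hn' : Even n := ⟨m, hm⟩
  have hM := card_weilIndexSet_eq_card_filter_add (n := n) hd0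
  rw [if_pos ⟨hd2, hn'⟩] at hM
  have hη := isQuadratic_apply_eq_quadraticChar (isQuadratic_pow_div_two hd2 hχ) (pow_div_two_ne_one hd2 hd0 hχ)
    ((-1 : k) ^ (n / 2 + 1) * ∏ i, (β i : k))
  apply Int.cast_injective (α := ℂ)
  rw [intCast_leadingCoeff_of_map_eq_prod hχ β hψ hP₁, prod_neg_recipRoot_of_even hd2 hn' hd0 hχ β hψ,
    centralRecipRoot_eq hn' hd2 hd0 hχ β hψ, hη, hM]
  have hsq : ((Real.sqrt (Fintype.card k) : ℂ) ^ n) = (Fintype.card k : ℂ) ^ m := by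
    rw [hm, ← two_mul, pow_mul, ← Complex.ofReal_pow, Real.sq_sqrt (Nat.cast_nonneg _), Complex.ofReal_natCast]
  rw [hsq, show n / 2 = m by omega, show n * (#(((Fintype.piFinset fun _ : Fin (n + 2) ↦ range d).filter
      fun a => (∀ i, a i ≠ 0) ∧ d ∣ ∑ i, a i).filter (fun a => ¬(fun i => d - a i) = a)) + 1) / 2 =
      m * (#(((Fintype.piFinset fun _ : Fin (n + 2) ↦ range d).filter
        fun a => (∀ i, a i ≠ 0) ∧ d ∣ ∑ i, a i).filter (fun a => ¬(fun i => d - a i) = a)) + 1) by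
      rw [hm, ← two_mul, mul_assoc, Nat.mul_div_cancel_left _ two_pos]]
  push_cast
  ring

end LeadingCoeff

/-! ### §3 The determinant of Frobenius on the middle cohomology -/

namespace GaloisWeilCohomology

open Literature.NumberTheory.LFunctions (isWeilFactorization_of_isIntegralModel)

section Odd

variable {k : Type u} [Field k] [Finite k] {K : Type v} [Field K] [CharZero K]
  {χ : Field.absoluteGaloisGroup k →* Kˣ} (E : GaloisWeilCohomology k K χ)
variable {n d : ℕ} {β : Fin (n + 2) → kˣ}

/-- **`det(F | Hⁿ(X)) = q^{n·bₙ/2}` for the diagonal hypersurface when `n` or `d` is odd** (`n ≥ 1`, `d ∣ q − 1`; `n·bₙ`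
is even): all reciprocal roots pair off as `{α, qⁿ/α}` under `a ↦ a'` (no fixed point), plus the real root `q^{n/2}`
of `1 − q^{n/2}T` when `n` is even — `det(π) > 0`, Kahn's sign `+1` (Exercise 6.56; for `n` odd without any hard
Lefschetz hypothesis).  In a Galois Weil cohomology `E` with the trace formula, `χ(φ) = q`, granted RH for `X` in `E`.
[cite: Kahn2020, §6.13 Prop. 6.46 (3) and Exercise 6.56] [cite: Deligne1974, Th. (1.6)] [cite: Weil1949, p. 507] -/
theorem det_frobAction_diagonalHypersurface_middle (hE : E.HasLefschetzTraceFormula)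
    (hχ : ((χ (arithFrob k) : Kˣ) : K) = Nat.card k) (hn : 0 < n) (h : Odd n ∨ Odd d) (hd : d ∣ Nat.card k - 1)
    (hRH : E.WeilRiemannHypothesisFor
      (hypersurface (∑ i, MvPolynomial.C (β i : k) * MvPolynomial.X i ^ d : MvPolynomial (Fin (n + 2)) k)) n) :
    LinearMap.det (E.frobAction
        (hypersurface (∑ i, MvPolynomial.C (β i : k) * MvPolynomial.X i ^ d : MvPolynomial (Fin (n + 2)) k)) n) =
      (Nat.card k : K) ^ (n * (haveI := E.finite_obj (isSmoothProjective_diagonalHypersurface_of_dvd hn hd β) n;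
        Module.finrank K (E.obj (hypersurface (∑ i, MvPolynomial.C (β i : k) * MvPolynomial.X i ^ d :
          MvPolynomial (Fin (n + 2)) k)) n)) / 2) := by
  classical
  letI := Fintype.ofFinite k
  letI : Fintype (ℙ k (Fin (n + 2) → k)) := Fintype.ofFinite _
  haveI : Fact (ringChar k).Prime := ⟨CharP.char_is_prime k (ringChar k)⟩
  letI : Algebra (ZMod (ringChar k)) k := ZMod.algebra k (ringChar k)
  have hX := isSmoothProjective_diagonalHypersurface_of_dvd hn hd β
  have hd' : d ∣ Fintype.card k - 1 := by rwa [Fintype.card_eq_nat_card]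
  have hd0 : d ≠ 0 := by
    rintro rfl
    rw [zero_dvd_iff] at hd
    have := Finite.one_lt_card (α := k)
    omega
  obtain ⟨χ₁, hχ₁⟩ := MulChar.exists_mulChar_orderOf k hd' (Complex.isPrimitiveRoot_exp d hd0)
  have hψ := FiniteFieldTraceCharacter.traceChar_ne_one k (ringChar k)
  -- the integral model `(1 − q^{n/2}T)^{[n even]} · P₁` of `Pₙ`
  obtain ⟨P, hP, hroots⟩ := hRH
  have hW := isWeilFactorization_of_isIntegralModel E hE hχ hX hP hroots
  obtain ⟨P₁, s, h1, h2, h3, h4, -⟩ := weil1949_zetaSeries_diagonalHypersurface (n := n) hd β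
  rw [algebraMap_int_eq] at h1
  have hW₀ := isWeilFactorization_of_middle_numerator Nat.card_pos hn h1 (fun α hα => (h2 α hα).1) h3 h4
  have hP₁ := weil1949Numerator_map_eq hd hχ₁ β hψ h3 h4
  have hmodel := hP ⟨n, by omega⟩
  rw [hW.unique Finite.one_lt_card hW₀] at hmodel
  dsimp only at hmodel
  rw [if_pos rfl] at hmodel
  -- `det F = (−1)^{deg} lc`, `finrank = deg`
  rw [E.finrank_eq_natDegree_of_isIntegralModel hX hmodel, E.det_frobAction_eq_intCast_of_isIntegralModel hX hmodel]
  have hP₁0 : P₁ ≠ 0 := fun h0 => by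
    have := congrArg (Polynomial.map (Int.castRingHom ℂ)) h0
    rw [hP₁, Polynomial.map_zero] at this
    exact (Finset.prod_ne_zero_iff.mpr fun a ha => by
      intro hz
      have := congrArg (Polynomial.coeff · 0) hz
      simp at this) this
  have hdegP₁ := natDegree_eq_card_weilIndexSet_of_map_eq_prod hχ₁ β hψ hP₁
  have hlcP₁ := leadingCoeff_eq_pow_of_map_eq_prod h hd' hχ₁ β hψ hP₁
  rw [Fintype.card_eq_nat_card] at hlcP₁
  obtain ⟨m, hm⟩ := even_mul_card_weilIndexSet_of_not (n := n) hd0 h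
  rcases Nat.even_or_odd n with he | ho
  · -- `n` even, `d` odd: `deg = M + 1`, `lc = −q^{n/2} · q^{nM/2}`, `M` even
    have hdo : Odd d := h.resolve_left (Nat.not_odd_iff_even.mpr he)
    have hMe := even_card_weilIndexSet_of_not (n := n) hd0 (fun ⟨hd2, _⟩ => (Nat.not_even_iff_odd.mpr hdo) hd2)
    have hq0 : (1 - C ((Nat.card k : ℤ) ^ (n / 2)) * X : ℤ[X]) ≠ 0 := fun h0 => by
      have := congrArg (Polynomial.coeff · 0) h0
      simp at this
    have hdeg1 : (1 - C ((Nat.card k : ℤ) ^ (n / 2)) * X : ℤ[X]).natDegree = 1 := by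
      rw [sub_eq_add_neg, ← neg_mul, ← C_neg, add_comm, ← C_1]
      exact natDegree_linear (neg_ne_zero.mpr (pow_ne_zero _ (Nat.cast_ne_zero.mpr Nat.card_pos.ne')))
    have hlc1 : (1 - C ((Nat.card k : ℤ) ^ (n / 2)) * X : ℤ[X]).leadingCoeff = -((Nat.card k : ℤ) ^ (n / 2)) := by
      rw [sub_eq_add_neg, ← neg_mul, ← C_neg, add_comm, ← C_1]
      exact leadingCoeff_linear (neg_ne_zero.mpr (pow_ne_zero _ (Nat.cast_ne_zero.mpr Nat.card_pos.ne')))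
    rw [if_pos he, natDegree_mul hq0 hP₁0, leadingCoeff_mul, hdeg1, hlc1, hdegP₁, hlcP₁]
    obtain ⟨e, he'⟩ := he
    obtain ⟨M', hM'⟩ := hMe
    rw [hM', show n / 2 = e by omega, show n * (M' + M') / 2 = e * (M' + M') by
        rw [he', ← two_mul, ← two_mul, mul_assoc, Nat.mul_div_cancel_left _ two_pos, two_mul],
      show n * (1 + (M' + M')) / 2 = e * (1 + (M' + M')) by
        rw [he', ← two_mul, mul_assoc, Nat.mul_div_cancel_left _ two_pos],
      show (1 + (M' + M')) = 2 * M' + 1 by ring, pow_succ, pow_mul, neg_one_sq, one_pow, one_mul]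
    push_cast
    ring
  · -- `n` odd: `deg = M` even, `lc = q^{nM/2}`
    have hMe := even_card_weilIndexSet_of_not (n := n) hd0 (fun ⟨_, hn2⟩ => (Nat.not_even_iff_odd.mpr ho) hn2)
    rw [if_neg (Nat.not_even_iff_odd.mpr ho), one_mul, hdegP₁, hlcP₁]
    obtain ⟨M', hM'⟩ := hMe
    rw [hM', ← two_mul, pow_mul, neg_one_sq, one_pow, one_mul]
    push_cast
    rfl

end Odd

section Even

variable {k : Type u} [Field k] [Fintype k] [DecidableEq k] {K : Type v} [Field K] [CharZero K]
  {χ : Field.absoluteGaloisGroup k →* Kˣ} (E : GaloisWeilCohomology k K χ)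
variable {n d : ℕ} {β : Fin (n + 2) → kˣ}

/-- **`det(F | Hⁿ(X)) = (Δ/𝔽_q) · q^{n·bₙ/2}` for the diagonal hypersurface when `n` and `d` are both even** (`n ≥ 1`,
`d ∣ q − 1`, `Δ = (−1)^{n/2+1}β₀⋯β_{n+1}`, `(Δ/𝔽_q)` the Legendre symbol = Mathlib's `quadraticChar`): besides the pairs
`{α, qⁿ/α}` and the root `q^{n/2}` of `1 − q^{n/2}T` there is the single REAL Jacobi-sum root
`α_{a₀} = (Δ/𝔽_q)·q^{n/2}` — Kahn's «This sign may be `−1`!» (Remark 3.66: the quadric surface of non-square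
discriminant, `N₋ = 1`), here as the hypothesis `hε` of the tree's `functionalEquation_zetaSeries_sign_of_even`
discharged.  In a Galois Weil cohomology `E` with the trace formula, `χ(φ) = q`, granted RH for `X` in `E`.
[cite: Kahn2020, §3.6 Remark 3.66; §6.13 Prop. 6.46 (3)] [cite: Deligne1974, Th. (1.6)] [cite: Weil1949, p. 507] -/
theorem det_frobAction_diagonalHypersurface_middle_of_even (hE : E.HasLefschetzTraceFormula)
    (hχ : ((χ (arithFrob k) : Kˣ) : K) = Nat.card k) (hn : 0 < n) (hne : Even n) (hd2 : Even d)
    (hd : d ∣ Nat.card k - 1)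
    (hRH : E.WeilRiemannHypothesisFor
      (hypersurface (∑ i, MvPolynomial.C (β i : k) * MvPolynomial.X i ^ d : MvPolynomial (Fin (n + 2)) k)) n) :
    LinearMap.det (E.frobAction
        (hypersurface (∑ i, MvPolynomial.C (β i : k) * MvPolynomial.X i ^ d : MvPolynomial (Fin (n + 2)) k)) n) =
      ((quadraticChar k ((-1) ^ (n / 2 + 1) * ∏ i, (β i : k)) : ℤ) : K) *
        (Nat.card k : K) ^ (n * (haveI := E.finite_obj (isSmoothProjective_diagonalHypersurface_of_dvd hn hd β) n;
          Module.finrank K (E.obj (hypersurface (∑ i, MvPolynomial.C (β i : k) * MvPolynomial.X i ^ d :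
            MvPolynomial (Fin (n + 2)) k)) n)) / 2) := by
  classical
  letI : Fintype (ℙ k (Fin (n + 2) → k)) := Fintype.ofFinite _
  haveI : Fact (ringChar k).Prime := ⟨CharP.char_is_prime k (ringChar k)⟩
  letI : Algebra (ZMod (ringChar k)) k := ZMod.algebra k (ringChar k)
  have hX := isSmoothProjective_diagonalHypersurface_of_dvd hn hd β
  have hd' : d ∣ Fintype.card k - 1 := by rwa [Fintype.card_eq_nat_card]
  have hd0 : d ≠ 0 := by
    rintro rfl
    rw [zero_dvd_iff] at hd
    have := Finite.one_lt_card (α := k)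
    omega
  obtain ⟨χ₁, hχ₁⟩ := MulChar.exists_mulChar_orderOf k hd' (Complex.isPrimitiveRoot_exp d hd0)
  have hψ := FiniteFieldTraceCharacter.traceChar_ne_one k (ringChar k)
  obtain ⟨P, hP, hroots⟩ := hRH
  have hW := isWeilFactorization_of_isIntegralModel E hE hχ hX hP hroots
  obtain ⟨P₁, s, h1, h2, h3, h4, -⟩ := weil1949_zetaSeries_diagonalHypersurface (n := n) hd β
  rw [algebraMap_int_eq] at h1
  have hW₀ := isWeilFactorization_of_middle_numerator Nat.card_pos hn h1 (fun α hα => (h2 α hα).1) h3 h4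
  have hP₁ := weil1949Numerator_map_eq hd hχ₁ β hψ h3 h4
  have hmodel := hP ⟨n, by omega⟩
  rw [hW.unique Finite.one_lt_card hW₀] at hmodel
  dsimp only at hmodel
  rw [if_pos rfl] at hmodel
  rw [E.finrank_eq_natDegree_of_isIntegralModel hX hmodel, E.det_frobAction_eq_intCast_of_isIntegralModel hX hmodel]
  have hP₁0 : P₁ ≠ 0 := fun h0 => by
    have := congrArg (Polynomial.map (Int.castRingHom ℂ)) h0
    rw [hP₁, Polynomial.map_zero] at this
    exact (Finset.prod_ne_zero_iff.mpr fun a ha => by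
      intro hz
      have := congrArg (Polynomial.coeff · 0) hz
      simp at this) this
  have hdegP₁ := natDegree_eq_card_weilIndexSet_of_map_eq_prod hχ₁ β hψ hP₁
  have hlcP₁ := leadingCoeff_eq_neg_quadraticChar_mul_pow_of_map_eq_prod hne hd2 hd' hχ₁ β hψ hP₁
  rw [Fintype.card_eq_nat_card] at hlcP₁
  have hM := card_weilIndexSet_eq_card_filter_add (n := n) hd0
  rw [if_pos ⟨hd2, hne⟩] at hM
  have hq0 : (1 - C ((Nat.card k : ℤ) ^ (n / 2)) * X : ℤ[X]) ≠ 0 := fun h0 => by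
    have := congrArg (Polynomial.coeff · 0) h0
    simp at this
  have hdeg1 : (1 - C ((Nat.card k : ℤ) ^ (n / 2)) * X : ℤ[X]).natDegree = 1 := by
    rw [sub_eq_add_neg, ← neg_mul, ← C_neg, add_comm, ← C_1]
    exact natDegree_linear (neg_ne_zero.mpr (pow_ne_zero _ (Nat.cast_ne_zero.mpr Nat.card_pos.ne')))
  have hlc1 : (1 - C ((Nat.card k : ℤ) ^ (n / 2)) * X : ℤ[X]).leadingCoeff = -((Nat.card k : ℤ) ^ (n / 2)) := by
    rw [sub_eq_add_neg, ← neg_mul, ← C_neg, add_comm, ← C_1]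
    exact leadingCoeff_linear (neg_ne_zero.mpr (pow_ne_zero _ (Nat.cast_ne_zero.mpr Nat.card_pos.ne')))
  rw [if_pos hne, natDegree_mul hq0 hP₁0, leadingCoeff_mul, hdeg1, hlc1, hdegP₁, hlcP₁, hM]
  obtain ⟨e, he'⟩ := hne
  obtain ⟨M', hM'⟩ := even_card_filter_weilIndex_compl_ne (n := n) (d := d)
  rw [hM', show n / 2 = e by omega, show n * (M' + M' + 1) / 2 = e * (M' + M' + 1) by
      rw [he', ← two_mul, mul_assoc, Nat.mul_div_cancel_left _ two_pos],
    show n * (1 + (M' + M' + 1)) / 2 = e * (1 + (M' + M' + 1)) by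
      rw [he', ← two_mul, mul_assoc, Nat.mul_div_cancel_left _ two_pos],
    show 1 + (M' + M' + 1) = 2 * (M' + 1) by ring, pow_mul, neg_one_sq, one_pow, one_mul]
  push_cast
  ring

end Even

end GaloisWeilCohomology

end Literature.AlgebraicGeometry.Motives
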